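import Literature.NumberTheory.K2Lit.LocalDoublingUnramifiedHecke

/-!
# The doubling Hecke operator of a bi-`K`-invariant kernel on a spherical Hecke eigenvector: `T(Λ) u = c(Λ, t, ev) · u`
# (LOCAL SEAM of s23, spine of #28s ∕ #30)

Track B ∕ K2-LIT, hLiu418 = stmt-HodgeConjecture-24832; DEPMAP `Cruxes/HLiu418/Lines/K2_Liu_LocalSeam_s23.md` §0 (a), §3 rows #28s–#30.
Helper (count-neutral, own head per LEAD R3), GENERIC: `G` a measurable group, `K ≤ G`, `t : ι → G` a ★ D7d `IsCartanFamily` (`G = ⨆_i K t_i K`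
disjointly, `ι` countable, the double cosets measurable — e.g. `K` open), `Λ : G → ℂ` bi-`K`-invariant, `τ : G → (V →L[ℂ] V)`, `u` a ★ D7d
`IsSphericalHeckeEigen ν K t τ u ev` (`∫_{K t_i K} τ g u dν = ev i • u`). THEN, as soon as `g ↦ Λ g • τ g u` is integrable
(★ D7b `DoublingHeckeOpConverges`):

* `hasSum_integral_doubleCoset`: `∑_i Λ(t_i) ev_i • u` converges to `T(Λ) u = ∫_G Λ g • τ g u dν` (★ D7b `doublingHeckeOp`);
* `cLocSummable_of_ne_zero`: for `u ≠ 0` the scalar series ★ D7d `cLoc t Λ ev = ∑' i Λ(t_i) ev_i` converges (★ `CLocSummable`);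
* **`isDoublingHeckeEigenvector_cLoc`**: `u` is a ★ D7b `IsDoublingHeckeEigenvector ν Λ τ u (cLoc t Λ ev)` — `T(Λ) u = c · u`.

This is the HECKE FORM of the unramified local doubling computation ([Li1992, §3 Thm. 3.1]; [GelbartPiatetskishapiroRallis1987, Part A §6];
[Liu2011, §2C (2-4) p. 863]) with the scalar left as the Cartan series; #27 (★ `lambdaLoc_iotaLeftLocPi_diagonal_split`) evaluates `Λ(t_i)`
and #26 (★ `isCartanFamily_localInt_split`) supplies the family at split places. Pure measure theory (`MeasureTheory.hasSum_integral_iUnion`);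
no `def`, no `sorry`. HONEST LABEL: HC_CM is proved only modulo the printed citations (2 remaining named inputs: hLiu418 = stmt-HodgeConjecture-24832,
h413 = stmt-HodgeConjecture-24833) until rung 0 closes; this file is unconditional and moves no counter.
-/

set_option autoImplicit false

set_option linter.dupNamespace false

noncomputable section

open MeasureTheory

namespace Summit.HodgeConjecture.HodgeConjecture.Cruxes.HLiu418.K2LiuDoublingHeckeCartanSum

open Literature.NumberTheory.K2Lit.SiegelDoubled

variable {G : Type} [Group G] [MeasurableSpace G] {ι : Type} [Countable ι]
  {V : Type} [NormedAddCommGroup V] [NormedSpace ℂ V]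

/-! ## §1 The double cosets of a Cartan family as a measurable partition -/

omit [MeasurableSpace G] [Countable ι] in
/-- the double cosets of a Cartan family cover `G`. [cite: Li1992, §3] -/
theorem iUnion_doubleCoset_eq_univ {K : Subgroup G} {t : ι → G} (ht : IsCartanFamily K t) :
    (⋃ i, DoubleCoset.doubleCoset (t i) (K : Set G) K) = Set.univ :=
  Set.eq_univ_of_forall fun g => Set.mem_iUnion.2 (ht.1 g)

omit [MeasurableSpace G] [Countable ι] in
/-- the double cosets of a Cartan family are pairwise disjoint. [cite: Li1992, §3] -/
theorem pairwise_disjoint_doubleCoset {K : Subgroup G} {t : ι → G} (ht : IsCartanFamily K t) :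
    Pairwise fun i j => Disjoint (DoubleCoset.doubleCoset (t i) (K : Set G) K) (DoubleCoset.doubleCoset (t j) (K : Set G) K) :=
  fun i j hij => Set.disjoint_iff_inter_eq_empty.2 (Set.not_nonempty_iff_eq_empty.1 fun h => hij (ht.2 i j h))

omit [MeasurableSpace G] [Countable ι] in
/-- a bi-`K`-invariant kernel is constant on each double coset: `Λ = Λ(t_i)` on `K t_i K`. [cite: Li1992, §3] -/
theorem apply_eq_of_mem_doubleCoset {K : Subgroup G} {Λ : G → ℂ} (hΛ : ∀ x ∈ K, ∀ y ∈ K, ∀ g : G, Λ (x * g * y) = Λ g)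
    {a g : G} (hg : g ∈ DoubleCoset.doubleCoset a (K : Set G) K) : Λ g = Λ a := by
  obtain ⟨x, hx, y, hy, rfl⟩ := DoubleCoset.mem_doubleCoset.1 hg
  exact hΛ x hx y hy a

omit [Countable ι] in
/-- in a topological group with an OPEN `K` every double coset `K a K` is open, hence measurable. [cite: Li1992, §3] -/
theorem measurableSet_doubleCoset [TopologicalSpace G] [IsTopologicalGroup G] [BorelSpace G] {K : Subgroup G}
    (hK : IsOpen (K : Set G)) (a : G) : MeasurableSet (DoubleCoset.doubleCoset a (K : Set G) K) := by
  unfold DoubleCoset.doubleCoset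
  exact (IsOpen.mul_left hK).measurableSet

/-! ## §2 `T(Λ) u = (∑_i Λ(t_i) ev_i) • u` -/

/-- **the Cartan series of the doubling Hecke operator**: `∑_i (Λ(t_i) ev_i) • u` converges to `T(Λ) u = ∫_G Λ g • τ g u dν`.
[cite: Li1992, §3 Thm. 3.1] [cite: GelbartPiatetskishapiroRallis1987, Part A §6] -/
theorem hasSum_integral_doubleCoset (ν : Measure G) {K : Subgroup G} {t : ι → G} (ht : IsCartanFamily K t)
    (hm : ∀ i, MeasurableSet (DoubleCoset.doubleCoset (t i) (K : Set G) K))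
    {Λ : G → ℂ} (hΛ : ∀ x ∈ K, ∀ y ∈ K, ∀ g : G, Λ (x * g * y) = Λ g)
    {τ : G → V →L[ℂ] V} {u : V} {ev : ι → ℂ} (hu : IsSphericalHeckeEigen ν K t τ u ev)
    (hint : DoublingHeckeOpConverges ν Λ τ u) :
    HasSum (fun i => (Λ (t i) * ev i) • u) (doublingHeckeOp ν Λ τ u) := by
  have hsum := hasSum_integral_iUnion (μ := ν) (f := fun g => Λ g • τ g u) hm (pairwise_disjoint_doubleCoset ht) hint.integrableOn
  rw [iUnion_doubleCoset_eq_univ ht, Measure.restrict_univ] at hsum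
  refine hsum.congr_fun fun i => ?_
  -- on `K t_i K`: `∫ Λ g • τ g u = Λ(t_i) • ∫ τ g u = (Λ(t_i) ev_i) • u`
  have heq : Set.EqOn (fun g => Λ g • τ g u) (fun g => Λ (t i) • τ g u) (DoubleCoset.doubleCoset (t i) (K : Set G) K) :=
    fun g hg => by simp only [apply_eq_of_mem_doubleCoset hΛ hg]
  show (Λ (t i) * ev i) • u = ∫ g in DoubleCoset.doubleCoset (t i) (K : Set G) K, Λ g • τ g u ∂ν
  rw [setIntegral_congr_fun (hm i) heq, integral_smul, (hu.2 i).2, smul_smul]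

/-- **summability of the local scalar series** `c(Λ, t, ev) = ∑' i Λ(t_i) ev_i` for `u ≠ 0`. [cite: Li1992, §3 Thm. 3.1] -/
theorem cLocSummable_of_ne_zero (ν : Measure G) {K : Subgroup G} {t : ι → G} (ht : IsCartanFamily K t)
    (hm : ∀ i, MeasurableSet (DoubleCoset.doubleCoset (t i) (K : Set G) K))
    {Λ : G → ℂ} (hΛ : ∀ x ∈ K, ∀ y ∈ K, ∀ g : G, Λ (x * g * y) = Λ g)
    {τ : G → V →L[ℂ] V} {u : V} {ev : ι → ℂ} (hu : IsSphericalHeckeEigen ν K t τ u ev)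
    (hint : DoublingHeckeOpConverges ν Λ τ u) (hu0 : u ≠ 0) : CLocSummable t Λ ev := by
  -- evaluate a norming functional `φ` (`φ u = ‖u‖`) on the convergent vector series
  obtain ⟨φ, -, hφ⟩ := exists_dual_vector ℂ u (norm_ne_zero_iff.2 hu0)
  have hφ0 : φ u ≠ 0 := by rw [hφ, Ne, RCLike.ofReal_eq_zero]; exact norm_ne_zero_iff.2 hu0
  have h1 : Summable fun i => φ ((Λ (t i) * ev i) • u) := (φ.hasSum (hasSum_integral_doubleCoset ν ht hm hΛ hu hint)).summable
  simp only [map_smul, smul_eq_mul] at h1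
  exact (h1.mul_right (φ u)⁻¹).congr fun i => by rw [mul_assoc, mul_inv_cancel₀ hφ0, mul_one]

/-- **THE HECKE FORM OF THE UNRAMIFIED COMPUTATION**: for a Cartan family `t`, a bi-`K`-invariant kernel `Λ` with `Λ • τ u` integrable and a
`K`-spherical Hecke eigenvector `u` (`∫_{K t_i K} τ g u = ev_i • u`), `T(Λ) u = ∫_G Λ g • τ g u dν = c(Λ, t, ev) • u` with
`c(Λ, t, ev) = ∑' i Λ(t_i) ev_i` (★ `cLoc`). [cite: Li1992, §3 Thm. 3.1] [cite: GelbartPiatetskishapiroRallis1987, Part A §6] [cite: Liu2011, §2C p. 863] -/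
theorem isDoublingHeckeEigenvector_cLoc (ν : Measure G) {K : Subgroup G} {t : ι → G} (ht : IsCartanFamily K t)
    (hm : ∀ i, MeasurableSet (DoubleCoset.doubleCoset (t i) (K : Set G) K))
    {Λ : G → ℂ} (hΛ : ∀ x ∈ K, ∀ y ∈ K, ∀ g : G, Λ (x * g * y) = Λ g)
    {τ : G → V →L[ℂ] V} {u : V} {ev : ι → ℂ} (hu : IsSphericalHeckeEigen ν K t τ u ev)
    (hint : DoublingHeckeOpConverges ν Λ τ u) :
    IsDoublingHeckeEigenvector ν Λ τ u (cLoc t Λ ev) := by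
  refine ⟨hint, ?_⟩
  by_cases hu0 : u = 0
  · -- `u = 0`: both sides vanish
    subst hu0
    rw [smul_zero]
    exact doublingHeckeOp_zero ν Λ τ
  · have hs := cLocSummable_of_ne_zero ν ht hm hΛ hu hint hu0
    rw [← (hasSum_integral_doubleCoset ν ht hm hΛ hu hint).tsum_eq, cLoc, hs.tsum_smul_const]

/-- the same, in a topological group with `K` OPEN (then every `K t_i K` is measurable). [cite: Li1992, §3 Thm. 3.1] -/
theorem isDoublingHeckeEigenvector_cLoc_of_isOpen [TopologicalSpace G] [IsTopologicalGroup G] [BorelSpace G] (ν : Measure G)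
    {K : Subgroup G} (hK : IsOpen (K : Set G)) {t : ι → G} (ht : IsCartanFamily K t)
    {Λ : G → ℂ} (hΛ : ∀ x ∈ K, ∀ y ∈ K, ∀ g : G, Λ (x * g * y) = Λ g)
    {τ : G → V →L[ℂ] V} {u : V} {ev : ι → ℂ} (hu : IsSphericalHeckeEigen ν K t τ u ev)
    (hint : DoublingHeckeOpConverges ν Λ τ u) :
    IsDoublingHeckeEigenvector ν Λ τ u (cLoc t Λ ev) :=
  isDoublingHeckeEigenvector_cLoc ν ht (fun i => measurableSet_doubleCoset hK (t i)) hΛ hu hint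

/-! ## §3 Central translates of double cosets: `∫_{K (z g) K} τ u = τ(z) ∫_{K g K} τ u` -/

omit [MeasurableSpace G] [Countable ι] in
/-- for `z` commuting with `K`, `x ∈ K (z g) K ↔ z⁻¹ x ∈ K g K`; as a preimage: `(z · )⁻¹(K (z g) K) = K g K`. [cite: Li1992, §3] -/
theorem preimage_mul_left_doubleCoset {K : Subgroup G} {z : G} (hz : ∀ k ∈ K, k * z = z * k) (g : G) :
    (fun x => z * x) ⁻¹' DoubleCoset.doubleCoset (z * g) (K : Set G) K = DoubleCoset.doubleCoset g (K : Set G) K := by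
  ext x
  simp only [Set.mem_preimage, DoubleCoset.mem_doubleCoset]
  constructor
  · rintro ⟨a, ha, b, hb, h⟩
    refine ⟨a, ha, b, hb, mul_left_cancel (a := z) ?_⟩
    rw [h, ← mul_assoc, ← mul_assoc, hz a ha, mul_assoc z a g]
  · rintro ⟨a, ha, b, hb, rfl⟩
    exact ⟨a, ha, b, hb, by rw [← mul_assoc, ← mul_assoc, ← hz a ha, mul_assoc a z g]⟩

omit [MeasurableSpace G] [Countable ι] in
/-- the translated indicator: `𝟙_{K (z g) K}(z x) τ(z x) u = 𝟙_{K g K}(x) τ(z) τ(x) u`. [cite: Li1992, §3] -/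
theorem indicator_doubleCoset_mul_left {K : Subgroup G} {z : G} (hz : ∀ k ∈ K, k * z = z * k)
    {τ : G → V →L[ℂ] V} (hτ : ∀ x : G, τ (z * x) = (τ z).comp (τ x)) (u : V) (g x : G) :
    (DoubleCoset.doubleCoset (z * g) (K : Set G) K).indicator (fun x => τ x u) (z * x) =
      (DoubleCoset.doubleCoset g (K : Set G) K).indicator (fun x => τ z (τ x u)) x := by
  have hx := (Set.indicator_comp_right (fun x => z * x) (s := DoubleCoset.doubleCoset (z * g) (K : Set G) K)
    (g := fun x => τ x u) (x := x)).symm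
  rw [preimage_mul_left_doubleCoset hz g] at hx
  rw [hx]
  congr 1
  funext y
  simp only [Function.comp_apply, hτ, ContinuousLinearMap.comp_apply]

omit [Countable ι] in
/-- **central translates**: for `z` commuting with `K`, a left-invariant `μ` and a multiplicative `τ`,
`∫_{K (z g) K} τ x u dμ = τ(z) (∫_{K g K} τ x u dμ)` (when the latter integrand is integrable). [cite: Li1992, §3] [cite: Macdonald1995, Ch. V §2] -/
theorem setIntegral_doubleCoset_mul_left [MeasurableMul G] [CompleteSpace V] (μ : Measure G) [μ.IsMulLeftInvariant] {K : Subgroup G}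
    (hm : ∀ a : G, MeasurableSet (DoubleCoset.doubleCoset a (K : Set G) K)) {z : G} (hz : ∀ k ∈ K, k * z = z * k)
    {τ : G → V →L[ℂ] V} (hτ : ∀ x : G, τ (z * x) = (τ z).comp (τ x)) (u : V) (g : G)
    (hint : IntegrableOn (fun x => τ x u) (DoubleCoset.doubleCoset g (K : Set G) K) μ) :
    ∫ x in DoubleCoset.doubleCoset (z * g) (K : Set G) K, τ x u ∂μ = τ z (∫ x in DoubleCoset.doubleCoset g (K : Set G) K, τ x u ∂μ) := by
  rw [← integral_indicator (hm _), ← integral_mul_left_eq_self _ z]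
  simp only [indicator_doubleCoset_mul_left hz hτ u g]
  rw [integral_indicator (hm _), ContinuousLinearMap.integral_comp_comm _ hint]

omit [Countable ι] in
/-- … and integrability transfers to the translate. [cite: Li1992, §3] -/
theorem integrableOn_doubleCoset_mul_left [MeasurableMul G] (μ : Measure G) [μ.IsMulLeftInvariant] {K : Subgroup G}
    (hm : ∀ a : G, MeasurableSet (DoubleCoset.doubleCoset a (K : Set G) K)) {z : G} (hz : ∀ k ∈ K, k * z = z * k)
    {τ : G → V →L[ℂ] V} (hτ : ∀ x : G, τ (z * x) = (τ z).comp (τ x)) (u : V) (g : G)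
    (hint : IntegrableOn (fun x => τ x u) (DoubleCoset.doubleCoset g (K : Set G) K) μ) :
    IntegrableOn (fun x => τ x u) (DoubleCoset.doubleCoset (z * g) (K : Set G) K) μ := by
  rw [← integrable_indicator_iff (hm _)]
  have h1 : Integrable ((DoubleCoset.doubleCoset g (K : Set G) K).indicator fun x => τ z (τ x u)) μ :=
    (integrable_indicator_iff (hm _)).2 ((τ z).integrable_comp hint)
  refine (h1.comp_mul_left z⁻¹).congr (Filter.Eventually.of_forall fun x => ?_)
  have hx := indicator_doubleCoset_mul_left hz hτ u g (z⁻¹ * x)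
  rw [mul_inv_cancel_left] at hx
  exact hx.symm

omit [Countable ι] in
/-- **eigenvalues along central translates**: if `∫_{K g K} τ x u = e • u` and `τ(z) u = ω • u` (`z` commuting with `K`), then
`∫_{K (z g) K} τ x u = (ω e) • u`. [cite: Li1992, §3] [cite: Macdonald1995, Ch. V §2] -/
theorem setIntegral_doubleCoset_mul_left_eq_smul [MeasurableMul G] [CompleteSpace V] (μ : Measure G) [μ.IsMulLeftInvariant]
    {K : Subgroup G} (hm : ∀ a : G, MeasurableSet (DoubleCoset.doubleCoset a (K : Set G) K)) {z : G} (hz : ∀ k ∈ K, k * z = z * k)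
    {τ : G → V →L[ℂ] V} (hτ : ∀ x : G, τ (z * x) = (τ z).comp (τ x)) {u : V} {ω e : ℂ} (hω : τ z u = ω • u) (g : G)
    (hint : IntegrableOn (fun x => τ x u) (DoubleCoset.doubleCoset g (K : Set G) K) μ)
    (he : ∫ x in DoubleCoset.doubleCoset g (K : Set G) K, τ x u ∂μ = e • u) :
    ∫ x in DoubleCoset.doubleCoset (z * g) (K : Set G) K, τ x u ∂μ = (ω * e) • u := by
  rw [setIntegral_doubleCoset_mul_left μ hm hz hτ u g hint, he, map_smul, hω, smul_smul, mul_comm]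

end Summit.HodgeConjecture.HodgeConjecture.Cruxes.HLiu418.K2LiuDoublingHeckeCartanSum

end
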